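/-
Copyright: statement-level skeleton of a published paper (lit-balaban cell, Phase-2 proof seat p20, gen 3). No claims beyond
what the kernel checks below.
-/
import Literature.MathematicalPhysics.QuantumFieldTheory.Balaban1983to89.B3Sect3Subtraction319
import Literature.MathematicalPhysics.QuantumFieldTheory.Balaban1983to89.B3Sect3VectorSelfEnergy

/-!
# `Balaban1983to89.B3SubtractionAlphaGain` — T. Bałaban, *(Higgs)₂,₃ quantum fields in a finite volume. III. Renormalization*,
Commun. Math. Phys. **88** (1983) 411–445 [Balaban1983Higgs3], pp. 438 and 442: the gain `(L^jη)^α` of the mass-subtracted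
degree-0 self-energy terms — *"(3.19) … generalized expression of degree +α"* and *"the first term on the right side [of (3.31)]
is convergent"*, PROVED as quantitative bounds

statement-level skeleton of published theorems with citation tags; proofs where landed; nothing here is a claim about the Yang–Mills mass gap

PDF held: `paper:balaban1983-higgs-2-3-quantum-fields-finite-volume` (journal page = PDF page + 410); pp. 438, 442 read on the ×2
renders `run/shared/lean/pub/pub-balaban/b2b-balaban-ref1/pages/1983-cmp88-higgs23-III/1983-cmp88-higgs23-III-p028-x2.png`,
`…-p032-x2.png`.

CITATION HEADER (lean-in-tree rule).  lit-balaban PHASE 2, seat p20 (gen 3), rows **B3.Eq3.18-3.20** and **B3.Eq3.25-3.32**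
(owner r15, referee ref-4).  r15 PROVED the two subtraction identities as algebra: (3.19) `B3Sect3Subtraction319.eq319`
(`subtracted319 = holderForm319`) and (3.31) `B3Sect3VectorSelfEnergy.eq331` (the pairing `pairSum` with the leg
`|x′−x|^α·(g′A′(x′) − g′A′(x))/|x′−x|^α` plus the local term).  Page 438, verbatim: *"If Σ(x,x′) is a kernel of an arbitrary
graph of this class, then an expression corresponding to a mass renormalization counterterm is of the form −Σ_{x′}η^dΣ(x,x′) and
we have [(3.19)] hence we get a generalized expression of degree +α"*; page 442: *"We write [(3.31)] and the first term on the
right side is convergent."*  WHAT IS HERE: the quantitative content of "degree +α" / "convergent" in the sense of (2.14) and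
(3.13)–(3.14) — for a kernel obeying a (2.10)-type bound `|Σ(x,x′)| ≤ K e^{−δ(L^jη)^{−1}|x−x′|}` at scale `s = L^jη` and a
Hölder leg `|φ′(x′) − φ′(x)| ≤ H|x′−x|^α`, the subtracted expressions are bounded by `O(1)·K·H·s^α` times the degree-0 majorant
`Σ_{x,x′}η^{2d}|φ(x)|e^{−½δ|x−x′|/s}` (half of the exponential factor is kept, as on p. 436): `abs_subtracted319_le` ((3.19), fields
with values in a real inner-product space `W`, `Σ(x,x′) ∈ End W`) and `abs_first331_le` / `abs_pairSum_diff_le` ((3.31), r15's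
`pairSum` form), from the elementary `exp_mul_rpow_le`: `e^{−δu/s}u^α ≤ (1 + 2/δ)s^α e^{−½δu/s}` (`u ≥ 0`, `0 ≤ α ≤ 1`).
Distances: `|x − x′| = η·Site.tdist x x′` (the ℓ¹ torus distance of `Setup`, as in `B3Ineq313Pointwise`/`B3Ineq326Curly`); the
(3.31) weight is r15's `η·supDist` and cancels (`pairSum_weight_div`).  The kernel bounds (2.10)–(2.12) themselves and the value of
`K` for the graphs (3.18)/(3.30) are hypotheses `hSg`/`hKb` (Papers I/IV), not asserted.  Unit `lit-balaban-p20`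
(literature-prover-lit-balaban-p20-g3-0), 2026-08-21; HOME `run/shared/lean/pub/lit-balaban/` (FILED.md).
-/

open scoped BigOperators RealInnerProductSpace

namespace Literature.MathematicalPhysics.QuantumFieldTheory.Balaban1983to89.B3SubtractionAlphaGain

open LatticeFieldCalculus B3Sect3ScalarSelfEnergy B3Sect3VectorSelfEnergy B3Sect3Subtraction319

noncomputable section

/-! ## 1. The elementary gain: the weight `|x′−x|^α` against the exponential decay of a kernel of scale `s` -/

section Elementary

/-- `t^α ≤ 1 + t` for `t ≥ 0`, `0 ≤ α ≤ 1`. [folklore] -/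
private theorem rpow_le_one_add {t α : ℝ} (ht : 0 ≤ t) (hα0 : 0 ≤ α) (hα1 : α ≤ 1) : t ^ α ≤ 1 + t := by
  rcases le_or_gt t 1 with h | h
  · have h1 : t ^ α ≤ 1 := Real.rpow_le_one ht h hα0
    linarith
  · have h1 : t ^ α ≤ t ^ (1 : ℝ) := Real.rpow_le_rpow_of_exponent_le h.le hα1
    rw [Real.rpow_one] at h1
    linarith

/-- `t·e^{−a t} ≤ 1/a` for `a > 0`. [folklore] -/
private theorem mul_exp_neg_le {a : ℝ} (ha : 0 < a) (t : ℝ) : t * Real.exp (-(a * t)) ≤ 1 / a := by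
  have h1 : a * t ≤ Real.exp (a * t) := by
    have := Real.add_one_le_exp (a * t)
    linarith
  have h2 : a * t * Real.exp (-(a * t)) ≤ 1 := by
    calc a * t * Real.exp (-(a * t)) ≤ Real.exp (a * t) * Real.exp (-(a * t)) :=
          mul_le_mul_of_nonneg_right h1 (Real.exp_pos _).le
      _ = 1 := by rw [← Real.exp_add, add_neg_cancel, Real.exp_zero]
  rw [le_div_iff₀ ha]
  calc t * Real.exp (-(a * t)) * a = a * t * Real.exp (-(a * t)) := by ring
    _ ≤ 1 := h2

/-- kernel: `t^α e^{−a t} ≤ 1 + 1/a` (`t ≥ 0`, `0 ≤ α ≤ 1`, `a > 0`). [cite: Balaban1983Higgs3, (3.19) p.438] -/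
theorem rpow_mul_exp_neg_le {t α a : ℝ} (ht : 0 ≤ t) (hα0 : 0 ≤ α) (hα1 : α ≤ 1) (ha : 0 < a) :
    t ^ α * Real.exp (-(a * t)) ≤ 1 + 1 / a := by
  have he1 : Real.exp (-(a * t)) ≤ 1 := Real.exp_le_one_iff.mpr (by nlinarith)
  calc t ^ α * Real.exp (-(a * t)) ≤ (1 + t) * Real.exp (-(a * t)) :=
        mul_le_mul_of_nonneg_right (rpow_le_one_add ht hα0 hα1) (Real.exp_pos _).le
    _ = Real.exp (-(a * t)) + t * Real.exp (-(a * t)) := by ring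
    _ ≤ 1 + 1 / a := add_le_add he1 (mul_exp_neg_le ha t)

/-- p. 438 [PDF 28] *"a generalized expression of degree +α"*, the rescaled elementary bound: `u^α·e^{−a u/s} ≤ (1 + 1/a)·s^α`
(`u ≥ 0`, `s > 0`, `0 ≤ α ≤ 1`) — the weight `|x′−x|^α = u^α` costs exactly the power `s^α = (L^jη)^α` of the scale of the kernel.
[cite: Balaban1983Higgs3, (3.19) p.438] -/
theorem rpow_mul_exp_neg_le_scale {u α a s : ℝ} (hu : 0 ≤ u) (hα0 : 0 ≤ α) (hα1 : α ≤ 1) (ha : 0 < a) (hs : 0 < s) :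
    u ^ α * Real.exp (-(a * s⁻¹ * u)) ≤ (1 + 1 / a) * s ^ α := by
  have ht : 0 ≤ s⁻¹ * u := mul_nonneg (inv_nonneg.mpr hs.le) hu
  have key := rpow_mul_exp_neg_le ht hα0 hα1 ha
  have hu' : u = s * (s⁻¹ * u) := by rw [← mul_assoc, mul_inv_cancel₀ hs.ne', one_mul]
  have hpow : u ^ α = s ^ α * (s⁻¹ * u) ^ α := by
    rw [← Real.mul_rpow hs.le ht, ← hu']
  calc u ^ α * Real.exp (-(a * s⁻¹ * u))
      = s ^ α * ((s⁻¹ * u) ^ α * Real.exp (-(a * (s⁻¹ * u)))) := by rw [hpow, mul_assoc a]; ring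
    _ ≤ s ^ α * (1 + 1 / a) := mul_le_mul_of_nonneg_left key (Real.rpow_nonneg hs.le _)
    _ = (1 + 1 / a) * s ^ α := mul_comm _ _

/-- kernel: the gain combined with *"half of the exponential factor"* (p. 436): `e^{−δu/s}·u^α ≤ (1 + 2/δ)·s^α·e^{−½δu/s}`
(`u ≥ 0`, `δ, s > 0`, `0 ≤ α ≤ 1`). [cite: Balaban1983Higgs3, (3.19) p.438] -/
theorem exp_mul_rpow_le {δ s u α : ℝ} (hδ : 0 < δ) (hs : 0 < s) (hu : 0 ≤ u) (hα0 : 0 ≤ α) (hα1 : α ≤ 1) :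
    Real.exp (-(δ * s⁻¹ * u)) * u ^ α ≤ (1 + 2 / δ) * s ^ α * Real.exp (-(δ / 2 * s⁻¹ * u)) := by
  have hsplit : Real.exp (-(δ * s⁻¹ * u)) = Real.exp (-(δ / 2 * s⁻¹ * u)) * Real.exp (-(δ / 2 * s⁻¹ * u)) := by
    rw [← Real.exp_add]
    congr 1
    ring
  have key := rpow_mul_exp_neg_le_scale hu hα0 hα1 (half_pos hδ) hs
  rw [one_div_div] at key
  calc Real.exp (-(δ * s⁻¹ * u)) * u ^ α
      = (u ^ α * Real.exp (-(δ / 2 * s⁻¹ * u))) * Real.exp (-(δ / 2 * s⁻¹ * u)) := by rw [hsplit]; ring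
    _ ≤ ((1 + 2 / δ) * s ^ α) * Real.exp (-(δ / 2 * s⁻¹ * u)) :=
        mul_le_mul_of_nonneg_right key (Real.exp_pos _).le
    _ = (1 + 2 / δ) * s ^ α * Real.exp (-(δ / 2 * s⁻¹ * u)) := by ring

end Elementary

/-! ## 2. (3.19): the subtracted two-scalar-leg term is of degree `+α` -/

section Eq319

variable {P : Params} {j : ℕ} {W : Type*} [NormedAddCommGroup W] [InnerProductSpace ℝ W]

/-- kernel: the left side of (3.19) as ONE double sum, `Σ_{x,x′}η^{2d}φ(x)·Σ(x,x′)(φ′(x′) − φ′(x))` (the first half of r15's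
`eq319`, before the weight is inserted and divided). [cite: Balaban1983Higgs3, (3.19) p.438] -/
theorem subtracted319_eq_sum (η : ℝ) (Sg : Site P j → Site P j → W →ₗ[ℝ] W) (φ φ' : SiteField P j W) :
    subtracted319 η Sg φ φ' = ∑ x : Site P j, ∑ x' : Site P j, η ^ (2 * P.d) * ⟪φ x, Sg x x' (φ' x' - φ' x)⟫ := by
  have h2d : η ^ (2 * P.d) = η ^ P.d * η ^ P.d := by rw [two_mul, pow_add]
  have hct : ∑ x : Site P j, η ^ P.d * ⟪φ x, (∑ x' : Site P j, η ^ P.d • Sg x x') (φ' x)⟫ =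
      ∑ x : Site P j, ∑ x' : Site P j, η ^ (2 * P.d) * ⟪φ x, Sg x x' (φ' x)⟫ := by
    refine Finset.sum_congr rfl fun x _ => ?_
    rw [LinearMap.sum_apply, inner_sum, Finset.mul_sum]
    refine Finset.sum_congr rfl fun x' _ => ?_
    rw [LinearMap.smul_apply, real_inner_smul_right, h2d]
    ring
  unfold subtracted319
  rw [hct, ← Finset.sum_sub_distrib]
  refine Finset.sum_congr rfl fun x _ => ?_
  rw [← Finset.sum_sub_distrib]
  refine Finset.sum_congr rfl fun x' _ => ?_
  rw [← mul_sub, ← inner_sub_right, ← map_sub]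

/-- **(3.19) p. 438 [PDF 28] is "a generalized expression of degree +α" — quantitative form, PROVED.**  For a kernel
`Σ(x,x′) ∈ End W` with the (2.10)-type bound `‖Σ(x,x′)v‖ ≤ K e^{−δ|x−x′|/s}‖v‖` (scale `s = L^jη` of the graph) and a Hölder leg
`‖φ′(x′) − φ′(x)‖ ≤ H|x′−x|^α` (`0 ≤ α ≤ 1`, `|x−x′| = η·tdist`):
`|Σ_{x,x′}η^{2d}φ(x)·Σ(x,x′)φ′(x′) − Σ_xη^dφ(x)·(Σ_{x′}η^dΣ(x,x′))φ′(x)| ≤ K·H·(1 + 2/δ)·s^α·Σ_{x,x′}η^{2d}‖φ(x)‖e^{−½δ|x−x′|/s}`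
— the degree-0 majorant of the unsubtracted term (with `sup‖φ′‖` replaced by `H`) times the gain `s^α = (L^jη)^α`.
[cite: Balaban1983Higgs3, (3.19) p.438] -/
theorem abs_subtracted319_le (η : ℝ) (hη : 0 < η) {α H K δ s : ℝ} (hα0 : 0 ≤ α) (hα1 : α ≤ 1) (hH : 0 ≤ H) (hK : 0 ≤ K)
    (hδ : 0 < δ) (hs : 0 < s) (Sg : Site P j → Site P j → W →ₗ[ℝ] W) (φ φ' : SiteField P j W)
    (hSg : ∀ (x x' : Site P j) (v : W), ‖Sg x x' v‖ ≤ K * Real.exp (-(δ * s⁻¹ * (η * Site.tdist x x'))) * ‖v‖)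
    (hφ' : ∀ x x' : Site P j, ‖φ' x' - φ' x‖ ≤ H * (η * Site.tdist x x') ^ α) :
    |subtracted319 η Sg φ φ'| ≤ K * H * (1 + 2 / δ) * s ^ α *
      ∑ x : Site P j, ∑ x' : Site P j, η ^ (2 * P.d) * (‖φ x‖ * Real.exp (-(δ / 2 * s⁻¹ * (η * Site.tdist x x')))) := by
  rw [subtracted319_eq_sum]
  have hterm : ∀ x x' : Site P j, |η ^ (2 * P.d) * ⟪φ x, Sg x x' (φ' x' - φ' x)⟫| ≤
      K * H * (1 + 2 / δ) * s ^ α * (η ^ (2 * P.d) * (‖φ x‖ * Real.exp (-(δ / 2 * s⁻¹ * (η * Site.tdist x x'))))) := by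
    intro x x'
    set u : ℝ := η * Site.tdist x x' with hu
    have hu0 : 0 ≤ u := mul_nonneg hη.le (Nat.cast_nonneg _)
    rw [abs_mul, abs_of_nonneg (by positivity : (0 : ℝ) ≤ η ^ (2 * P.d))]
    have h1 : |⟪φ x, Sg x x' (φ' x' - φ' x)⟫| ≤ ‖φ x‖ * ‖Sg x x' (φ' x' - φ' x)‖ := abs_real_inner_le_norm _ _
    have h2 : ‖Sg x x' (φ' x' - φ' x)‖ ≤ K * Real.exp (-(δ * s⁻¹ * u)) * (H * u ^ α) :=
      (hSg x x' _).trans (mul_le_mul_of_nonneg_left (hφ' x x') (by positivity))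
    have hw := exp_mul_rpow_le hδ hs hu0 hα0 hα1
    calc η ^ (2 * P.d) * |⟪φ x, Sg x x' (φ' x' - φ' x)⟫|
        ≤ η ^ (2 * P.d) * (‖φ x‖ * (K * Real.exp (-(δ * s⁻¹ * u)) * (H * u ^ α))) :=
          mul_le_mul_of_nonneg_left (h1.trans (mul_le_mul_of_nonneg_left h2 (norm_nonneg _))) (by positivity)
      _ = η ^ (2 * P.d) * ‖φ x‖ * (K * H) * (Real.exp (-(δ * s⁻¹ * u)) * u ^ α) := by ring
      _ ≤ η ^ (2 * P.d) * ‖φ x‖ * (K * H) * ((1 + 2 / δ) * s ^ α * Real.exp (-(δ / 2 * s⁻¹ * u))) :=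
          mul_le_mul_of_nonneg_left hw (by positivity)
      _ = _ := by ring
  calc |∑ x : Site P j, ∑ x' : Site P j, η ^ (2 * P.d) * ⟪φ x, Sg x x' (φ' x' - φ' x)⟫|
      ≤ ∑ x : Site P j, |∑ x' : Site P j, η ^ (2 * P.d) * ⟪φ x, Sg x x' (φ' x' - φ' x)⟫| :=
        Finset.abs_sum_le_sum_abs _ _
    _ ≤ ∑ x : Site P j, ∑ x' : Site P j, |η ^ (2 * P.d) * ⟪φ x, Sg x x' (φ' x' - φ' x)⟫| :=
        Finset.sum_le_sum fun x _ => Finset.abs_sum_le_sum_abs _ _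
    _ ≤ ∑ x : Site P j, ∑ x' : Site P j, K * H * (1 + 2 / δ) * s ^ α *
          (η ^ (2 * P.d) * (‖φ x‖ * Real.exp (-(δ / 2 * s⁻¹ * (η * Site.tdist x x'))))) :=
        Finset.sum_le_sum fun x _ => Finset.sum_le_sum fun x' _ => hterm x x'
    _ = _ := by
        rw [Finset.mul_sum]
        exact Finset.sum_congr rfl fun x _ => by rw [Finset.mul_sum]

end Eq319

/-! ## 3. (3.31): the first term on the right side is convergent -/

section Eq331

variable {P : Params} {j : ℕ}

/-- kernel: on the torus, sup-distance 0 means equality. [folklore] -/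
private theorem eq_of_supDist_eq_zero (x x' : Site P j) (h : supDist x x' = 0) : x = x' := by
  funext μ
  have hle : min (x μ - x' μ).val (x' μ - x μ).val ≤ supDist x x' :=
    Finset.le_sup (f := fun μ : Fin P.d => min (x μ - x' μ).val (x' μ - x μ).val) (Finset.mem_univ μ)
  rw [h, Nat.le_zero, Nat.min_eq_zero_iff, ZMod.val_eq_zero, ZMod.val_eq_zero, sub_eq_zero, sub_eq_zero] at hle
  rcases hle with h1 | h1
  · exact h1
  · exact h1.symm

/-- kernel: inside the pairing of (3.31) the inserted-and-divided weight cancels termwise — for a weight `w` vanishing only on the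
diagonal and a leg `D` vanishing on the diagonal, `pairSum η K g A (w·(D/w)) = pairSum η K g A D`.
[cite: Balaban1983Higgs3, (3.31) p.442] -/
theorem pairSum_weight_div (η : ℝ) (K : Fin P.d → Fin P.d → Kernel P j) (g : SiteField P j ℝ) (A : VecField P j ℝ)
    (w : Site P j → Site P j → ℝ) (hw : ∀ x x' : Site P j, w x x' = 0 → x = x')
    (D : Fin P.d → Site P j → Site P j → ℝ) (hD : ∀ (μ' : Fin P.d) (x : Site P j), D μ' x x = 0) :
    pairSum η K g A (fun μ' x x' => w x x' * (D μ' x x' / w x x')) = pairSum η K g A D := by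
  unfold pairSum
  refine Finset.sum_congr rfl fun x _ => Finset.sum_congr rfl fun x' _ => ?_
  congr 1
  refine Finset.sum_congr rfl fun μ _ => Finset.sum_congr rfl fun μ' _ => ?_
  beta_reduce
  by_cases h0 : w x x' = 0
  · obtain rfl := hw x x' h0
    simp [hD]
  · rw [mul_div_cancel₀ _ h0]

/-- **(3.31) p. 442, the first term with a plain difference leg — quantitative bound, PROVED.**  For kernels `Π_{μμ′}(x,x′)` of the
degree-0 graphs with the (2.10)-type bound `|Π_{μμ′}(x,x′)| ≤ K₀e^{−δ|x−x′|/s}` and a Hölder leg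
`|g′A′_{μ′}(x′) − g′A′_{μ′}(x)| ≤ H|x′−x|^α`:
`|Σ_{x,x′}η^{2d}Σ_{μμ′}gA_μ(x)Π_{μμ′}(x,x′)(g′A′_{μ′}(x′) − g′A′_{μ′}(x))| ≤ d·K₀·H·(1 + 2/δ)·s^α·Σ_{x,x′}η^{2d}(Σ_μ|gA_μ(x)|)e^{−½δ|x−x′|/s}`.
[cite: Balaban1983Higgs3, (3.31) p.442] -/
theorem abs_pairSum_diff_le (η : ℝ) (hη : 0 < η) {α H K₀ δ s : ℝ} (hα0 : 0 ≤ α) (hα1 : α ≤ 1) (hH : 0 ≤ H) (hK : 0 ≤ K₀)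
    (hδ : 0 < δ) (hs : 0 < s) (K : Fin P.d → Fin P.d → Kernel P j) (g g' : SiteField P j ℝ) (A A' : VecField P j ℝ)
    (hKb : ∀ (μ μ' : Fin P.d) (x x' : Site P j), |K μ μ' x x'| ≤ K₀ * Real.exp (-(δ * s⁻¹ * (η * Site.tdist x x'))))
    (hφ' : ∀ (μ' : Fin P.d) (x x' : Site P j),
      |g' x' * A' ⟨x', μ'⟩ - g' x * A' ⟨x, μ'⟩| ≤ H * (η * Site.tdist x x') ^ α) :
    |pairSum η K g A (fun μ' x x' => g' x' * A' ⟨x', μ'⟩ - g' x * A' ⟨x, μ'⟩)| ≤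
      P.d * K₀ * H * (1 + 2 / δ) * s ^ α *
        ∑ x : Site P j, ∑ x' : Site P j, η ^ (2 * P.d) *
          ((∑ μ : Fin P.d, |g x * A ⟨x, μ⟩|) * Real.exp (-(δ / 2 * s⁻¹ * (η * Site.tdist x x')))) := by
  set C : ℝ := P.d * K₀ * H * (1 + 2 / δ) * s ^ α with hC
  -- the bound per (x, x′, μ, μ′)
  have hterm : ∀ (x x' : Site P j) (μ μ' : Fin P.d),
      |g x * A ⟨x, μ⟩ * K μ μ' x x' * (g' x' * A' ⟨x', μ'⟩ - g' x * A' ⟨x, μ'⟩)| ≤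
        |g x * A ⟨x, μ⟩| * (K₀ * H * ((1 + 2 / δ) * s ^ α * Real.exp (-(δ / 2 * s⁻¹ * (η * Site.tdist x x'))))) := by
    intro x x' μ μ'
    set u : ℝ := η * Site.tdist x x' with hu
    have hu0 : 0 ≤ u := mul_nonneg hη.le (Nat.cast_nonneg _)
    have hw := exp_mul_rpow_le hδ hs hu0 hα0 hα1
    have hk := hKb μ μ' x x'
    have hl := hφ' μ' x x'
    calc |g x * A ⟨x, μ⟩ * K μ μ' x x' * (g' x' * A' ⟨x', μ'⟩ - g' x * A' ⟨x, μ'⟩)|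
        = |g x * A ⟨x, μ⟩| * |K μ μ' x x'| * |g' x' * A' ⟨x', μ'⟩ - g' x * A' ⟨x, μ'⟩| := by rw [abs_mul, abs_mul]
      _ ≤ |g x * A ⟨x, μ⟩| * (K₀ * Real.exp (-(δ * s⁻¹ * u))) * (H * u ^ α) :=
          mul_le_mul (mul_le_mul_of_nonneg_left hk (abs_nonneg _)) hl (abs_nonneg _) (by positivity)
      _ = |g x * A ⟨x, μ⟩| * (K₀ * H) * (Real.exp (-(δ * s⁻¹ * u)) * u ^ α) := by ring
      _ ≤ |g x * A ⟨x, μ⟩| * (K₀ * H) * ((1 + 2 / δ) * s ^ α * Real.exp (-(δ / 2 * s⁻¹ * u))) :=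
          mul_le_mul_of_nonneg_left hw (by positivity)
      _ = _ := by ring
  -- summation over μ, μ′ at fixed (x, x′)
  have hinner : ∀ x x' : Site P j,
      |η ^ (2 * P.d) * ∑ μ : Fin P.d, ∑ μ' : Fin P.d,
          g x * A ⟨x, μ⟩ * K μ μ' x x' * (g' x' * A' ⟨x', μ'⟩ - g' x * A' ⟨x, μ'⟩)| ≤
        C * (η ^ (2 * P.d) * ((∑ μ : Fin P.d, |g x * A ⟨x, μ⟩|) * Real.exp (-(δ / 2 * s⁻¹ * (η * Site.tdist x x'))))) := by
    intro x x'
    set E : ℝ := Real.exp (-(δ / 2 * s⁻¹ * (η * Site.tdist x x'))) with hE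
    rw [abs_mul, abs_of_nonneg (by positivity : (0 : ℝ) ≤ η ^ (2 * P.d))]
    have hsum : |∑ μ : Fin P.d, ∑ μ' : Fin P.d,
          g x * A ⟨x, μ⟩ * K μ μ' x x' * (g' x' * A' ⟨x', μ'⟩ - g' x * A' ⟨x, μ'⟩)| ≤
        ∑ μ : Fin P.d, ∑ _μ' : Fin P.d, |g x * A ⟨x, μ⟩| * (K₀ * H * ((1 + 2 / δ) * s ^ α * E)) := by
      refine (Finset.abs_sum_le_sum_abs _ _).trans (Finset.sum_le_sum fun μ _ => ?_)
      exact (Finset.abs_sum_le_sum_abs _ _).trans (Finset.sum_le_sum fun μ' _ => hterm x x' μ μ')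
    have hconst : ∑ μ : Fin P.d, ∑ _μ' : Fin P.d, |g x * A ⟨x, μ⟩| * (K₀ * H * ((1 + 2 / δ) * s ^ α * E))
        = P.d * (K₀ * H * ((1 + 2 / δ) * s ^ α)) * ((∑ μ : Fin P.d, |g x * A ⟨x, μ⟩|) * E) := by
      simp only [Finset.sum_const, Finset.card_univ, Fintype.card_fin, nsmul_eq_mul, Finset.sum_mul, Finset.mul_sum]
      exact Finset.sum_congr rfl fun μ _ => by ring
    calc η ^ (2 * P.d) * |∑ μ : Fin P.d, ∑ μ' : Fin P.d,
            g x * A ⟨x, μ⟩ * K μ μ' x x' * (g' x' * A' ⟨x', μ'⟩ - g' x * A' ⟨x, μ'⟩)|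
        ≤ η ^ (2 * P.d) * (P.d * (K₀ * H * ((1 + 2 / δ) * s ^ α)) * ((∑ μ : Fin P.d, |g x * A ⟨x, μ⟩|) * E)) := by
          rw [← hconst]
          exact mul_le_mul_of_nonneg_left hsum (by positivity)
      _ = C * (η ^ (2 * P.d) * ((∑ μ : Fin P.d, |g x * A ⟨x, μ⟩|) * E)) := by rw [hC]; ring
  -- summation over x, x′
  unfold pairSum
  calc |∑ x : Site P j, ∑ x' : Site P j, η ^ (2 * P.d) * ∑ μ : Fin P.d, ∑ μ' : Fin P.d,
          g x * A ⟨x, μ⟩ * K μ μ' x x' * (g' x' * A' ⟨x', μ'⟩ - g' x * A' ⟨x, μ'⟩)|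
      ≤ ∑ x : Site P j, |∑ x' : Site P j, η ^ (2 * P.d) * ∑ μ : Fin P.d, ∑ μ' : Fin P.d,
          g x * A ⟨x, μ⟩ * K μ μ' x x' * (g' x' * A' ⟨x', μ'⟩ - g' x * A' ⟨x, μ'⟩)| := Finset.abs_sum_le_sum_abs _ _
    _ ≤ ∑ x : Site P j, ∑ x' : Site P j, |η ^ (2 * P.d) * ∑ μ : Fin P.d, ∑ μ' : Fin P.d,
          g x * A ⟨x, μ⟩ * K μ μ' x x' * (g' x' * A' ⟨x', μ'⟩ - g' x * A' ⟨x, μ'⟩)| :=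
        Finset.sum_le_sum fun x _ => Finset.abs_sum_le_sum_abs _ _
    _ ≤ ∑ x : Site P j, ∑ x' : Site P j, C * (η ^ (2 * P.d) *
          ((∑ μ : Fin P.d, |g x * A ⟨x, μ⟩|) * Real.exp (-(δ / 2 * s⁻¹ * (η * Site.tdist x x'))))) :=
        Finset.sum_le_sum fun x _ => Finset.sum_le_sum fun x' _ => hinner x x'
    _ = C * ∑ x : Site P j, ∑ x' : Site P j, η ^ (2 * P.d) *
          ((∑ μ : Fin P.d, |g x * A ⟨x, μ⟩|) * Real.exp (-(δ / 2 * s⁻¹ * (η * Site.tdist x x')))) := by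
        rw [Finset.mul_sum]
        exact Finset.sum_congr rfl fun x _ => by rw [Finset.mul_sum]

/-- **p. 442 [PDF 32]: "… (3.31) and the first term on the right side is convergent" — quantitative form, PROVED** for r15's
typed first term of (3.31) (`B3Sect3VectorSelfEnergy.eq331`: the leg `|x′−x|^α·(g′A′_{μ′}(x′) − g′A′_{μ′}(x))/|x′−x|^α` with
`|x′−x| = η·supDist`): under the (2.10)-type kernel bound `|Π_{μμ′}(x,x′)| ≤ K₀e^{−δ|x−x′|/s}` (scale `s = L^jη`) and the Hölder
bound `|g′A′_{μ′}(x′) − g′A′_{μ′}(x)| ≤ H(η·tdist x x′)^α`, `0 ≤ α ≤ 1`, it is at most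
`d·K₀·H·(1 + 2/δ)·s^α·Σ_{x,x′}η^{2d}(Σ_μ|gA_μ(x)|)e^{−½δ η·tdist(x,x′)/s}` — the degree-0 majorant times the gain `s^α = (L^jη)^α`,
which is what makes the term "convergent" (degree `+α > 0`) in the bookkeeping of (2.14)/(3.14). [cite: Balaban1983Higgs3, (3.31) p.442] -/
theorem abs_first331_le (η α : ℝ) (hη : 0 < η) {H K₀ δ s : ℝ} (hα0 : 0 ≤ α) (hα1 : α ≤ 1) (hH : 0 ≤ H) (hK : 0 ≤ K₀)
    (hδ : 0 < δ) (hs : 0 < s) (K : Fin P.d → Fin P.d → Kernel P j) (g g' : SiteField P j ℝ) (A A' : VecField P j ℝ)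
    (hKb : ∀ (μ μ' : Fin P.d) (x x' : Site P j), |K μ μ' x x'| ≤ K₀ * Real.exp (-(δ * s⁻¹ * (η * Site.tdist x x'))))
    (hφ' : ∀ (μ' : Fin P.d) (x x' : Site P j),
      |g' x' * A' ⟨x', μ'⟩ - g' x * A' ⟨x, μ'⟩| ≤ H * (η * Site.tdist x x') ^ α) :
    |pairSum η K g A (fun μ' x x' => (η * supDist x x') ^ α *
        ((g' x' * A' ⟨x', μ'⟩ - g' x * A' ⟨x, μ'⟩) / (η * supDist x x') ^ α))| ≤
      P.d * K₀ * H * (1 + 2 / δ) * s ^ α *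
        ∑ x : Site P j, ∑ x' : Site P j, η ^ (2 * P.d) *
          ((∑ μ : Fin P.d, |g x * A ⟨x, μ⟩|) * Real.exp (-(δ / 2 * s⁻¹ * (η * Site.tdist x x')))) := by
  have hw : ∀ x x' : Site P j, (η * (supDist x x' : ℝ)) ^ α = 0 → x = x' := fun x x' h0 => by
    have hnn : 0 ≤ η * (supDist x x' : ℝ) := by positivity
    rw [Real.rpow_eq_zero_iff_of_nonneg hnn] at h0
    have h1 : (supDist x x' : ℝ) = 0 := by
      rcases mul_eq_zero.1 h0.1 with h2 | h2
      · exact absurd h2 hη.ne'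
      · exact h2
    exact eq_of_supDist_eq_zero x x' (by exact_mod_cast h1)
  rw [pairSum_weight_div η K g A (fun x x' => (η * (supDist x x' : ℝ)) ^ α) hw
    (fun μ' x x' => g' x' * A' ⟨x', μ'⟩ - g' x * A' ⟨x, μ'⟩) (fun μ' x => sub_self _)]
  exact abs_pairSum_diff_le η hη hα0 hα1 hH hK hδ hs K g g' A A' hKb hφ'

end Eq331

end

end Literature.MathematicalPhysics.QuantumFieldTheory.Balaban1983to89.B3SubtractionAlphaGain
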